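import Summits.CriticalPhenomena.Ising3DConformalLimit.Theorems.ArmDressingArmDressingGlueDefs
import Literature.Probability.LatticeModels.TwoPointSupNormMonotone
import Literature.Probability.LatticeModels.ThermodynamicLimit
import Literature.Probability.LatticeModels.HighDimPointwiseTriviality
import Literature.Barriers.CriticalPhenomena.LongRangeTrivialityOnZ3MarginalAudit
import HarnessLib

/-!
# Route `ArmDressing`, crux `ArmDressingGlue` (stmt-CriticalPhenomena-15700):
# stub `stub_boxTwoPointSums`

Two-point sums over boxes IN ONE-ARM UNITS (skeleton v3 of the line `registered` of the crux
`ArmDressingGlue`).  Write `G := ⟨σ_0 σ_·⟩⁺_{β_c(3)} = criticalTwoPoint 3` and `a(K) := arm1 K⁻¹ 1`.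
Assume the axis asymptotics `c a(k)² ≤ G(k e₁) ≤ C a(k)²` (`k ≥ k₀`), the dyadic doubling
`a(K/2) ≤ λ a(K)` (`K ≥ K₀`, `λ² < 8`), `a` antitone on `(0, ∞)` and `0 < a ≤ 1` on `[1, ∞)`.
Then for `M ≥ M₀`

* `G(y) ≥ c' a(M)²` for every `y` in the box `Λ_M = {‖y‖_∞ ≤ M}`, with `c' = c / λ⁴`;
* `∑_{y ∈ Λ_M} G(y) ≤ C' M³ a(M)²`.

This is pure lattice analysis; the only input on `G` besides the hypotheses is the
Messager–Miracle-Solé comparison in the sup norm (Aizenman–Duminil-Copin 2021, eq. (5.3); tree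
`twoPointPlus_le_of_mul_supNorm_le`): `G(y) ≤ G(x)` whenever `3 ‖x‖_∞ ≤ ‖y‖_∞`, and `0 ≤ G ≤ 1`.

Proof.  LOWER: for `y ∈ Λ_M`, `3‖y‖_∞ ≤ 3M = ‖3M e₁‖_∞`, so `G(y) ≥ G(3M e₁) ≥ c a(3M)²`, and
`a(M) ≤ a(3M/4) ≤ λ a(3M/2) ≤ λ² a(3M)`.  UPPER: by induction over dyadic scales,
`T(n) := ∑_{Λ_{2^n}} G ≤ C₁ (2^n)³ a(2^n)²` for `n ≥ i₀ + 3` (`2^{i₀} ≥ k₀, K₀`): the base case is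
`T ≤ #Λ` (as `G ≤ 1`) and the choice of `C₁`; for the step, `T(n+1) = T(n) + ∑_{shell} G`, where
`T(n) ≤ C₁ (2^n)³ a(2^n)² ≤ (C₁ λ²/8) (2^{n+1})³ a(2^{n+1})²` by doubling, and on the shell
`‖y‖_∞ > 2^n ≥ 3 · 2^{n-2}` so `G(y) ≤ G(2^{n-2} e₁) ≤ C a(2^{n-2})² ≤ C λ⁶ a(2^{n+1})²`, the shell
having at most `#Λ_{2^{n+1}} ≤ 27 (2^{n+1})³` points; since `λ² < 8` the constant
`C₁ ≥ 216 C λ⁶ / (8 - λ²)` reproduces itself.  Finally `Λ_M ⊆ Λ_{2^J}` with `M < 2^J ≤ 2M`, and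
`a(2^J) ≤ a(M)`.

References: M. Aizenman, H. Duminil-Copin, Ann. of Math. 194 (2021), §5.1 eq. (5.3)
(Messager–Miracle-Solé 1977); F. Camia, Y. Feng, arXiv:2411.01467, §3.2 (planar template of the
second-moment method in one-arm units).
-/

noncomputable section

namespace Summit.CriticalPhenomena.Ising3DConformalLimit.Cruxes.ArmDressingGlue.CrossPos

open Summit.CriticalPhenomena.Ising3DConformalLimit.Cruxes.ArmDressingGlue.Vocab
open Summit.CriticalPhenomena.Ising3DConformalLimit.Theses
open Literature.Probability.LatticeModels Literature.Probability.Percolation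
open Finset
open Literature.Barriers.CriticalPhenomena.LongRangeIsing (supNorm_single_zero_natCast)
open scoped BigOperators

/-! ## Moving lattice points to the first axis (Messager–Miracle-Solé)

`‖n e₁‖_∞ = n` is the tree's `LongRangeIsing.supNorm_single_zero_natCast`. -/

/-- MMS comparison, lower form: on the box `Λ_M` the critical two-point function is at least its
value at the axial point `3M e₁` (`3 ‖y‖_∞ ≤ 3M = ‖3M e₁‖_∞`). [cite: AizenmanDuminilCopinAnnals2021, eq. (5.3)] -/
theorem criticalTwoPoint_three_mul_le {M : ℕ} {y : Site 3} (hy : y ∈ box 3 M) :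
    criticalTwoPoint 3 (Pi.single 0 ((3 * M : ℕ) : ℤ)) ≤ criticalTwoPoint 3 y :=
  twoPointPlus_le_of_mul_supNorm_le (criticalBeta_nonneg 3)
    (by rw [supNorm_single_zero_natCast]
        exact Nat.mul_le_mul_left 3 (mem_box_iff_supNorm_le.1 hy))

/-- MMS comparison, upper form: if `3k ≤ ‖y‖_∞` then `G(y) ≤ G(k e₁)`. [cite: AizenmanDuminilCopinAnnals2021, eq. (5.3)] -/
theorem criticalTwoPoint_le_axis {k : ℕ} {y : Site 3} (hy : 3 * k ≤ Site.supNorm y) :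
    criticalTwoPoint 3 y ≤ criticalTwoPoint 3 (Pi.single 0 (k : ℤ)) :=
  twoPointPlus_le_of_mul_supNorm_le (criticalBeta_nonneg 3) (by rwa [supNorm_single_zero_natCast])

/-! ## The lower bound on a box -/

/-- Lower bound in one-arm units: if `c a(k)² ≤ G(k e₁)` for `k ≥ k₀`, `a(K/2) ≤ λ a(K)` for
`K ≥ K₀` and `a` is antitone on `(0,∞)`, then `(c/λ⁴) a(M)² ≤ G(y)` for `y ∈ Λ_M`, once
`M ≥ k₀, K₀, 1` (`G(y) ≥ G(3M e₁) ≥ c a(3M)²` and `a(M) ≤ a(3M/4) ≤ λ² a(3M)`). [cite: AizenmanDuminilCopinAnnals2021, eq. (5.3)] -/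
theorem box_lower (a : ℝ → ℝ) {c lam K₀ : ℝ} {k₀ M : ℕ}
    (hax : ∀ k : ℕ, k₀ ≤ k → c * a k ^ 2 ≤ criticalTwoPoint 3 (Pi.single 0 (k : ℤ)))
    (hlam : 0 < lam) (hdbl : ∀ K : ℝ, K₀ ≤ K → a (K / 2) ≤ lam * a K)
    (hanti : ∀ K K' : ℝ, 0 < K → K ≤ K' → a K' ≤ a K)
    (haM : 0 ≤ a M) (hc : 0 ≤ c) (hMk : k₀ ≤ M) (hMK : K₀ ≤ M) (hM : 1 ≤ M)
    {y : Site 3} (hy : y ∈ box 3 M) :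
    c / lam ^ 4 * a M ^ 2 ≤ criticalTwoPoint 3 y := by
  obtain ⟨N, hN⟩ : ∃ N : ℝ, N = ((3 * M : ℕ) : ℝ) := ⟨_, rfl⟩
  have hN3 : N = 3 * M := by rw [hN, Nat.cast_mul, Nat.cast_ofNat]
  have hMpos : (0:ℝ) < M := by exact_mod_cast hM
  have h1 : a (N / 2) ≤ lam * a N := hdbl N (by rw [hN3]; linarith)
  have h2 : a (N / 2 / 2) ≤ lam * a (N / 2) := hdbl (N / 2) (by rw [hN3]; linarith)
  have h3 : a M ≤ a (N / 2 / 2) := hanti _ _ (by rw [hN3]; linarith) (by rw [hN3]; linarith)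
  have hchain : a M ≤ lam ^ 2 * a N :=
    calc a M ≤ a (N / 2 / 2) := h3
      _ ≤ lam * a (N / 2) := h2
      _ ≤ lam * (lam * a N) := mul_le_mul_of_nonneg_left h1 hlam.le
      _ = lam ^ 2 * a N := by ring
  have hsq : a M ^ 2 ≤ lam ^ 4 * a N ^ 2 :=
    calc a M ^ 2 ≤ (lam ^ 2 * a N) ^ 2 := pow_le_pow_left₀ haM hchain 2
      _ = lam ^ 4 * a N ^ 2 := by ring
  have hl4 : 0 < lam ^ 4 := pow_pos hlam 4
  calc c / lam ^ 4 * a M ^ 2 ≤ c / lam ^ 4 * (lam ^ 4 * a N ^ 2) :=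
        mul_le_mul_of_nonneg_left hsq (div_nonneg hc hl4.le)
    _ = c * a N ^ 2 := by rw [← mul_assoc, div_mul_cancel₀ c hl4.ne']
    _ ≤ criticalTwoPoint 3 (Pi.single 0 ((3 * M : ℕ) : ℤ)) := by
        rw [hN]; exact hax (3 * M) (by omega)
    _ ≤ criticalTwoPoint 3 y := criticalTwoPoint_three_mul_le hy

/-! ## The upper bound on dyadic boxes -/

/-- Dyadic induction for the box sums: if `G(k e₁) ≤ C a(k)²` for `k ≥ k₀` (`C ≥ 0`),
`a(K/2) ≤ λ a(K)` for `K ≥ K₀` with `λ² < 8`, `0 < a` on `[1,∞)` and `2^{i₀} ≥ k₀, K₀`, then there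
is `C₁ ≥ 0` with `∑_{Λ_{2^{i+3}}} G ≤ C₁ (2^{i+3})³ a(2^{i+3})²` for all `i ≥ i₀` (base: `G ≤ 1`;
step: previous box by doubling, shell by the MMS comparison with `2^{i+1} e₁`, doubling thrice and
`#Λ_{2^{i+4}} ≤ 27 (2^{i+4})³`; the constant `C₁ ≥ 216 C λ⁶/(8 - λ²)` reproduces itself). [cite: AizenmanDuminilCopinAnnals2021, eq. (5.3)] -/
theorem dyadic_sum_le (a : ℝ → ℝ) {C lam K₀ : ℝ} {k₀ i₀ : ℕ}
    (hax : ∀ k : ℕ, k₀ ≤ k → criticalTwoPoint 3 (Pi.single 0 (k : ℤ)) ≤ C * a k ^ 2)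
    (hC : 0 ≤ C) (hlam : 0 < lam) (hlam8 : lam ^ 2 < 8)
    (hdbl : ∀ K : ℝ, K₀ ≤ K → a (K / 2) ≤ lam * a K)
    (hpos : ∀ K : ℝ, 1 ≤ K → 0 < a K)
    (hk : k₀ ≤ 2 ^ i₀) (hK : K₀ ≤ (2:ℝ) ^ i₀) :
    ∃ C₁ : ℝ, 0 ≤ C₁ ∧ ∀ i : ℕ, i₀ ≤ i →
      ∑ y ∈ box 3 (2 ^ (i + 3)), criticalTwoPoint 3 y ≤
        C₁ * ((2:ℝ) ^ (i + 3)) ^ 3 * a ((2:ℝ) ^ (i + 3)) ^ 2 := by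
  have hnn : ∀ n : ℕ, 0 ≤ a ((2:ℝ) ^ n) := fun n => (hpos _ (one_le_pow₀ (by norm_num))).le
  -- doubling along the dyadic scales
  have hdy : ∀ n : ℕ, i₀ ≤ n → a ((2:ℝ) ^ n) ≤ lam * a ((2:ℝ) ^ (n + 1)) := by
    intro n hn
    have e : (2:ℝ) ^ (n + 1) / 2 = 2 ^ n := by ring
    have h := hdbl ((2:ℝ) ^ (n + 1)) (hK.trans (pow_le_pow_right₀ (by norm_num) (by omega)))
    rwa [e] at h
  have hDpos : 0 < ((2:ℝ) ^ (i₀ + 3)) ^ 3 * a ((2:ℝ) ^ (i₀ + 3)) ^ 2 := by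
    have := hpos ((2:ℝ) ^ (i₀ + 3)) (one_le_pow₀ (by norm_num))
    positivity
  have h8 : 0 < 8 - lam ^ 2 := sub_pos.2 hlam8
  obtain ⟨C₁, hC₁a, hC₁b⟩ : ∃ C₁ : ℝ, 216 * C * lam ^ 6 / (8 - lam ^ 2) ≤ C₁ ∧
      ((#(box 3 (2 ^ (i₀ + 3)))) : ℝ) ≤
        C₁ * (((2:ℝ) ^ (i₀ + 3)) ^ 3 * a ((2:ℝ) ^ (i₀ + 3)) ^ 2) :=
    ⟨max (216 * C * lam ^ 6 / (8 - lam ^ 2))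
        (((#(box 3 (2 ^ (i₀ + 3)))) : ℝ) / (((2:ℝ) ^ (i₀ + 3)) ^ 3 * a ((2:ℝ) ^ (i₀ + 3)) ^ 2)),
      le_max_left _ _, (div_le_iff₀ hDpos).1 (le_max_right _ _)⟩
  have hC₁ : 0 ≤ C₁ := le_trans (div_nonneg (by positivity) h8.le) hC₁a
  have hkey : C₁ * lam ^ 2 / 8 + 27 * C * lam ^ 6 ≤ C₁ := by
    have h := (div_le_iff₀ h8).1 hC₁a
    nlinarith [h]
  refine ⟨C₁, hC₁, fun i hi => ?_⟩
  induction i, hi using Nat.le_induction with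
  | base =>
    calc ∑ y ∈ box 3 (2 ^ (i₀ + 3)), criticalTwoPoint 3 y
        ≤ ∑ _y ∈ box 3 (2 ^ (i₀ + 3)), (1:ℝ) := sum_le_sum fun y _ => criticalTwoPoint_le_one' y
      _ = ((#(box 3 (2 ^ (i₀ + 3)))) : ℝ) := by rw [sum_const, nsmul_eq_mul, mul_one]
      _ ≤ C₁ * (((2:ℝ) ^ (i₀ + 3)) ^ 3 * a ((2:ℝ) ^ (i₀ + 3)) ^ 2) := hC₁b
      _ = C₁ * ((2:ℝ) ^ (i₀ + 3)) ^ 3 * a ((2:ℝ) ^ (i₀ + 3)) ^ 2 := (mul_assoc _ _ _).symm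
  | succ i hi IH =>
    show ∑ y ∈ box 3 (2 ^ (i + 4)), criticalTwoPoint 3 y ≤
      C₁ * ((2:ℝ) ^ (i + 4)) ^ 3 * a ((2:ℝ) ^ (i + 4)) ^ 2
    -- comparing the scales `2^(i+3)` and `2^(i+1)` with `2^(i+4)`
    have hprev : a ((2:ℝ) ^ (i + 3)) ^ 2 ≤ lam ^ 2 * a ((2:ℝ) ^ (i + 4)) ^ 2 :=
      calc a ((2:ℝ) ^ (i + 3)) ^ 2 ≤ (lam * a ((2:ℝ) ^ (i + 4))) ^ 2 :=
            pow_le_pow_left₀ (hnn _) (hdy (i + 3) (by omega)) 2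
        _ = lam ^ 2 * a ((2:ℝ) ^ (i + 4)) ^ 2 := by ring
    have hfar : a ((2:ℝ) ^ (i + 1)) ^ 2 ≤ lam ^ 6 * a ((2:ℝ) ^ (i + 4)) ^ 2 := by
      have h : a ((2:ℝ) ^ (i + 1)) ≤ lam ^ 3 * a ((2:ℝ) ^ (i + 4)) :=
        calc a ((2:ℝ) ^ (i + 1)) ≤ lam * a ((2:ℝ) ^ (i + 2)) := hdy (i + 1) (by omega)
          _ ≤ lam * (lam * a ((2:ℝ) ^ (i + 3))) :=
              mul_le_mul_of_nonneg_left (hdy (i + 2) (by omega)) hlam.le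
          _ ≤ lam * (lam * (lam * a ((2:ℝ) ^ (i + 4)))) :=
              mul_le_mul_of_nonneg_left
                (mul_le_mul_of_nonneg_left (hdy (i + 3) (by omega)) hlam.le) hlam.le
          _ = lam ^ 3 * a ((2:ℝ) ^ (i + 4)) := by ring
      calc a ((2:ℝ) ^ (i + 1)) ^ 2 ≤ (lam ^ 3 * a ((2:ℝ) ^ (i + 4))) ^ 2 :=
            pow_le_pow_left₀ (hnn _) h 2
        _ = lam ^ 6 * a ((2:ℝ) ^ (i + 4)) ^ 2 := by ring
    -- pointwise bound on the shell `Λ_{2^(i+4)} \ Λ_{2^(i+3)}`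
    have hpt : ∀ y ∈ box 3 (2 ^ (i + 4)) \ box 3 (2 ^ (i + 3)),
        criticalTwoPoint 3 y ≤ C * lam ^ 6 * a ((2:ℝ) ^ (i + 4)) ^ 2 := by
      intro y hy
      simp only [mem_sdiff, mem_box_iff_supNorm_le, not_le] at hy
      have h4 : 2 ^ (i + 3) = 4 * 2 ^ (i + 1) := by ring
      have hsup : 3 * 2 ^ (i + 1) ≤ Site.supNorm y := by omega
      calc criticalTwoPoint 3 y ≤ criticalTwoPoint 3 (Pi.single 0 ((2 ^ (i + 1) : ℕ) : ℤ)) :=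
            criticalTwoPoint_le_axis hsup
        _ ≤ C * a ((2 ^ (i + 1) : ℕ) : ℝ) ^ 2 :=
            hax _ (hk.trans (Nat.pow_le_pow_right (by norm_num) (by omega)))
        _ = C * a ((2:ℝ) ^ (i + 1)) ^ 2 := by norm_num
        _ ≤ C * (lam ^ 6 * a ((2:ℝ) ^ (i + 4)) ^ 2) := mul_le_mul_of_nonneg_left hfar hC
        _ = C * lam ^ 6 * a ((2:ℝ) ^ (i + 4)) ^ 2 := by ring
    -- size of the shell
    have hcard : ((#(box 3 (2 ^ (i + 4)))) : ℝ) ≤ 27 * ((2:ℝ) ^ (i + 4)) ^ 3 := by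
      rw [card_box]
      push_cast
      have h1 : (1:ℝ) ≤ 2 ^ (i + 4) := one_le_pow₀ (by norm_num)
      calc ((2:ℝ) * 2 ^ (i + 4) + 1) ^ 3 ≤ (3 * 2 ^ (i + 4)) ^ 3 :=
            pow_le_pow_left₀ (by positivity) (by linarith) 3
        _ = 27 * ((2:ℝ) ^ (i + 4)) ^ 3 := by ring
    have hB : 0 ≤ C * lam ^ 6 * a ((2:ℝ) ^ (i + 4)) ^ 2 := by positivity
    have hshell : ∑ y ∈ box 3 (2 ^ (i + 4)) \ box 3 (2 ^ (i + 3)), criticalTwoPoint 3 y ≤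
        27 * ((2:ℝ) ^ (i + 4)) ^ 3 * (C * lam ^ 6 * a ((2:ℝ) ^ (i + 4)) ^ 2) :=
      calc ∑ y ∈ box 3 (2 ^ (i + 4)) \ box 3 (2 ^ (i + 3)), criticalTwoPoint 3 y
          ≤ ∑ _y ∈ box 3 (2 ^ (i + 4)) \ box 3 (2 ^ (i + 3)),
              C * lam ^ 6 * a ((2:ℝ) ^ (i + 4)) ^ 2 := sum_le_sum hpt
        _ = ((#(box 3 (2 ^ (i + 4)) \ box 3 (2 ^ (i + 3)))) : ℝ) *
              (C * lam ^ 6 * a ((2:ℝ) ^ (i + 4)) ^ 2) := by rw [sum_const, nsmul_eq_mul]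
        _ ≤ ((#(box 3 (2 ^ (i + 4)))) : ℝ) * (C * lam ^ 6 * a ((2:ℝ) ^ (i + 4)) ^ 2) :=
            mul_le_mul_of_nonneg_right (by exact_mod_cast card_le_card sdiff_subset) hB
        _ ≤ 27 * ((2:ℝ) ^ (i + 4)) ^ 3 * (C * lam ^ 6 * a ((2:ℝ) ^ (i + 4)) ^ 2) :=
            mul_le_mul_of_nonneg_right hcard hB
    -- splitting `Λ_{2^(i+4)}` into `Λ_{2^(i+3)}` and the shell
    have hsub : box 3 (2 ^ (i + 3)) ⊆ box 3 (2 ^ (i + 4)) :=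
      box_mono 3 (Nat.pow_le_pow_right (by norm_num) (by omega))
    have hX : 0 ≤ ((2:ℝ) ^ (i + 4)) ^ 3 * a ((2:ℝ) ^ (i + 4)) ^ 2 := by positivity
    calc ∑ y ∈ box 3 (2 ^ (i + 4)), criticalTwoPoint 3 y
        = ∑ y ∈ box 3 (2 ^ (i + 4)) \ box 3 (2 ^ (i + 3)), criticalTwoPoint 3 y +
            ∑ y ∈ box 3 (2 ^ (i + 3)), criticalTwoPoint 3 y := (sum_sdiff hsub).symm
      _ ≤ 27 * ((2:ℝ) ^ (i + 4)) ^ 3 * (C * lam ^ 6 * a ((2:ℝ) ^ (i + 4)) ^ 2) +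
            C₁ * ((2:ℝ) ^ (i + 3)) ^ 3 * a ((2:ℝ) ^ (i + 3)) ^ 2 := add_le_add hshell IH
      _ ≤ 27 * ((2:ℝ) ^ (i + 4)) ^ 3 * (C * lam ^ 6 * a ((2:ℝ) ^ (i + 4)) ^ 2) +
            C₁ * ((2:ℝ) ^ (i + 3)) ^ 3 * (lam ^ 2 * a ((2:ℝ) ^ (i + 4)) ^ 2) :=
          add_le_add le_rfl (mul_le_mul_of_nonneg_left hprev (by positivity))
      _ = (C₁ * lam ^ 2 / 8 + 27 * C * lam ^ 6) *
            (((2:ℝ) ^ (i + 4)) ^ 3 * a ((2:ℝ) ^ (i + 4)) ^ 2) := by ring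
      _ ≤ C₁ * (((2:ℝ) ^ (i + 4)) ^ 3 * a ((2:ℝ) ^ (i + 4)) ^ 2) :=
          mul_le_mul_of_nonneg_right hkey hX
      _ = C₁ * ((2:ℝ) ^ (i + 4)) ^ 3 * a ((2:ℝ) ^ (i + 4)) ^ 2 := (mul_assoc _ _ _).symm

/-! ## Assembly -/

/-- Box two-point sums in one-arm units, for an abstract scale function `a` (the stub with
`a(K) = arm1 K⁻¹ 1`): axis asymptotics `c a(k)² ≤ G(k e₁) ≤ C a(k)²`, dyadic doubling
`a(K/2) ≤ λ a(K)` with `λ² < 8`, antitonicity and positivity of `a` give `c', C', M₀` with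
`G ≥ c' a(M)²` on `Λ_M` and `∑_{Λ_M} G ≤ C' M³ a(M)²` for `M ≥ M₀` (lower bound `box_lower`;
upper bound `dyadic_sum_le` at the dyadic scale `2^J ∈ (M, 2M]`, then `a(2^J) ≤ a(M)`). [cite: AizenmanDuminilCopinAnnals2021, eq. (5.3)] -/
theorem boxTwoPointSums_of (a : ℝ → ℝ) {c C lam K₀ : ℝ} {k₀ : ℕ} (hc : 0 < c)
    (hax : ∀ k : ℕ, k₀ ≤ k →
      c * a k ^ 2 ≤ criticalTwoPoint 3 (Pi.single 0 (k : ℤ)) ∧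
        criticalTwoPoint 3 (Pi.single 0 (k : ℤ)) ≤ C * a k ^ 2)
    (hlam : 0 < lam) (hlam8 : lam ^ 2 < 8)
    (hdbl : ∀ K : ℝ, K₀ ≤ K → a (K / 2) ≤ lam * a K)
    (hanti : ∀ K K' : ℝ, 0 < K → K ≤ K' → a K' ≤ a K)
    (hpos : ∀ K : ℝ, 1 ≤ K → 0 < a K ∧ a K ≤ 1) :
    ∃ (c' C' : ℝ) (M₀ : ℕ), 0 < c' ∧ ∀ M : ℕ, M₀ ≤ M →
      (∀ y ∈ box 3 M, c' * a M ^ 2 ≤ criticalTwoPoint 3 y) ∧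
      ∑ y ∈ box 3 M, criticalTwoPoint 3 y ≤ C' * (M : ℝ) ^ 3 * a M ^ 2 := by
  -- a dyadic scale `2^i₀` beyond `k₀` and `K₀`
  obtain ⟨i₀, hk, hK⟩ : ∃ i₀ : ℕ, k₀ ≤ 2 ^ i₀ ∧ K₀ ≤ (2:ℝ) ^ i₀ := by
    refine ⟨k₀ + ⌈K₀⌉₊, (Nat.le_add_right _ _).trans Nat.lt_two_pow_self.le, ?_⟩
    calc K₀ ≤ (⌈K₀⌉₊ : ℝ) := Nat.le_ceil _
      _ ≤ ((k₀ + ⌈K₀⌉₊ : ℕ) : ℝ) := by exact_mod_cast Nat.le_add_left _ _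
      _ ≤ (2:ℝ) ^ (k₀ + ⌈K₀⌉₊) := by exact_mod_cast Nat.lt_two_pow_self.le
  have hC : 0 ≤ max C 0 := le_max_right _ _
  have hax' : ∀ k : ℕ, k₀ ≤ k →
      criticalTwoPoint 3 (Pi.single 0 (k : ℤ)) ≤ max C 0 * a k ^ 2 := fun k hk' =>
    (hax k hk').2.trans (mul_le_mul_of_nonneg_right (le_max_left _ _) (sq_nonneg _))
  obtain ⟨C₁, hC₁, hdy⟩ :=
    dyadic_sum_le a hax' hC hlam hlam8 hdbl (fun K hK' => (hpos K hK').1) hk hK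
  refine ⟨c / lam ^ 4, 8 * C₁, 2 ^ (i₀ + 3), div_pos hc (pow_pos hlam 4), fun M hM => ?_⟩
  have h83 : 2 ^ i₀ ≤ 2 ^ (i₀ + 3) := Nat.pow_le_pow_right (by norm_num) (by omega)
  have hM1 : 1 ≤ M := le_trans Nat.one_le_two_pow hM
  have hMpos : (0:ℝ) < M := by exact_mod_cast hM1
  refine ⟨fun y hy => ?_, ?_⟩
  · exact box_lower a (fun k hk' => (hax k hk').1) hlam hdbl hanti
      (hpos _ (by exact_mod_cast hM1)).1.le hc.le (hk.trans (h83.trans hM))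
      (hK.trans (by exact_mod_cast h83.trans hM)) hM1 hy
  · have hM0 : M ≠ 0 := by omega
    obtain ⟨J, hMJ, hJM⟩ : ∃ J : ℕ, M < 2 ^ J ∧ 2 ^ J ≤ 2 * M := by
      refine ⟨Nat.log 2 M + 1, Nat.lt_pow_succ_log_self (by norm_num) M, ?_⟩
      have := Nat.pow_log_le_self 2 hM0
      rw [pow_succ]
      omega
    have hJ : i₀ + 3 < J := (Nat.pow_lt_pow_iff_right (by norm_num)).1 (lt_of_le_of_lt hM hMJ)
    have hT := hdy (J - 3) (by omega)
    rw [show J - 3 + 3 = J by omega] at hT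
    have haJ : 0 ≤ a ((2:ℝ) ^ J) := (hpos _ (one_le_pow₀ (by norm_num))).1.le
    have h1 : ((2:ℝ) ^ J) ^ 3 ≤ (2 * (M:ℝ)) ^ 3 :=
      pow_le_pow_left₀ (by positivity) (by exact_mod_cast hJM) 3
    have h2 : a ((2:ℝ) ^ J) ^ 2 ≤ a (M:ℝ) ^ 2 :=
      pow_le_pow_left₀ haJ (hanti _ _ hMpos (by exact_mod_cast hMJ.le)) 2
    calc ∑ y ∈ box 3 M, criticalTwoPoint 3 y ≤ ∑ y ∈ box 3 (2 ^ J), criticalTwoPoint 3 y :=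
          sum_le_sum_of_subset_of_nonneg (box_mono 3 hMJ.le)
            fun y _ _ => criticalTwoPoint_nonneg' y
      _ ≤ C₁ * ((2:ℝ) ^ J) ^ 3 * a ((2:ℝ) ^ J) ^ 2 := hT
      _ ≤ C₁ * (2 * (M:ℝ)) ^ 3 * a (M:ℝ) ^ 2 :=
          mul_le_mul (mul_le_mul_of_nonneg_left h1 hC₁) h2 (sq_nonneg _) (by positivity)
      _ = 8 * C₁ * (M:ℝ) ^ 3 * a M ^ 2 := by ring

/-- **STUB `stub_boxTwoPointSums` — two-point sums over boxes in one-arm units** (pure lattice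
analysis: the Messager–Miracle-Solé sup-norm comparison `twoPointPlus_le_of_mul_supNorm_le`
(`criticalTwoPoint 3 = twoPointPlus 3 (criticalBeta 3)`) moves `y` with `‖y‖_∞ = m` to the axis
points `2^{i+1} e₁` on the dyadic shell `2^{i+3} < m ≤ 2^{i+4}` (upper) and `3M e₁` (lower); the
axis asymptotics turn these into `a(·)²`; the doubling chain compares scales; dyadic shells
`#{‖y‖_∞ ≤ 2^i} ≤ 27 · 8^i` and `λ² < 8` give `M³` by induction over the scales).  This is
`boxTwoPointSums_of` with `a(K) = arm1 K⁻¹ 1`. [cite: AizenmanDuminilCopinAnnals2021, eq. (5.3)] -/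
theorem stub_boxTwoPointSums :
    ∀ (c C : ℝ) (k₀ : ℕ), 0 < c →
      (∀ k : ℕ, k₀ ≤ k →
        c * arm1 (k : ℝ)⁻¹ 1 ^ 2 ≤ criticalTwoPoint 3 (Pi.single 0 (k : ℤ)) ∧
          criticalTwoPoint 3 (Pi.single 0 (k : ℤ)) ≤ C * arm1 (k : ℝ)⁻¹ 1 ^ 2) →
      ∀ (lam K₀ : ℝ), 0 < lam → lam ^ 2 < 8 → 0 < K₀ →
        (∀ K : ℝ, K₀ ≤ K → arm1 (K / 2)⁻¹ 1 ≤ lam * arm1 K⁻¹ 1) →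
        (∀ K K' : ℝ, 0 < K → K ≤ K' → arm1 K'⁻¹ 1 ≤ arm1 K⁻¹ 1) →
        (∀ K : ℝ, 1 ≤ K → 0 < arm1 K⁻¹ 1 ∧ arm1 K⁻¹ 1 ≤ 1) →
        ∃ (c' C' : ℝ) (M₀ : ℕ), 0 < c' ∧ ∀ M : ℕ, M₀ ≤ M →
          (∀ y ∈ box 3 M, c' * arm1 (M : ℝ)⁻¹ 1 ^ 2 ≤ criticalTwoPoint 3 y) ∧
          ∑ y ∈ box 3 M, criticalTwoPoint 3 y ≤ C' * (M : ℝ) ^ 3 * arm1 (M : ℝ)⁻¹ 1 ^ 2 :=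
  fun _ _ _ hc hax _ _ hlam hlam8 _ hdbl hanti hpos =>
    boxTwoPointSums_of (fun K => arm1 K⁻¹ 1) hc hax hlam hlam8 hdbl hanti hpos

end Summit.CriticalPhenomena.Ising3DConformalLimit.Cruxes.ArmDressingGlue.CrossPos

end
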